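import Summits.QuantumFields.BalabanUV.Beta.GAN24.EdgePotentialColumnOrthogonal
import Summits.QuantumFields.BalabanUV.Beta.GAN24.GaugeReadColumnSums
import Summits.QuantumFields.BalabanUV.Beta.GAN24.CoDressedColumnSourceSums
import Summits.QuantumFields.BalabanUV.Beta.GAN24.CombSlotDerivativeBorderRead

/-!
# `BalabanUV.Beta.GAN24.ExitPairingSourceForm` — binder row G-an2-4 ∕ (CONV-C), the (S) row of RULING R-gan24p1-g27-1 B (viii), the Ward-type half (W-γ) (road-P2 g39),
# EXIT class, jb = 0: **THE `(d*d)`-PAIRING OF A BOUNDED `Lc`-PERIODIC 1-FORM WITH A FIELD COLUMN OF `G₀ ∘ W` IS A PAIRING WITH THE SOURCE `W` ALONE —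
# `⟨(d*d) m, (G₀∘W)^F_{·xb}⟩ = ⟨Π^ρ m, W^F_{·xb}⟩ + (Lc^{d+1})⁻¹·Σ_κ (𝒬_{Lc} m)_κ·⟨𝟙^{exit}_κ, W^F_{·xb}⟩`; THE RESOLVENT IS GONE**
# (G-an2-4 formalisation swarm → CRUX TEAM (2), seat `b2b-balaban-gan24-formalise-leaf-06` = the (γ) hand, gen 46, INTENT 4; the structural half of ENGINE (M1)∕(M3))

NOT IN PRINT; OUR BOOKKEEPING ([folklore] BY NAME over: leaf-06 g46's `RelInvWardPairing.ward_pairing` and `EdgePotentialColumnOrthogonal` (the hard-axial representative, constant contour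
sums, zero `mm` column mass), leaf-06 g45's Fubini `GaugeReadColumnSums.tsum_comp_apply_eq_rowTotals`, leaf-02 g51's ROW SOURCE SUMS `CoDressedColumnSourceSums.tsum_source_rowH_coDressKBm_KInvStep`,
an2's `AxialDressingRooted.coDressKBmAt_KInvStep_inr_row_off ∕ _inr_col_off`, road-P2 g40's `CombSlotDerivativeBorderRead.tsum_coarse_of_off`; 0 `def`, 0 cited fact, 0 `def … : Prop`, 0 sorry).
HONEST FRAMING (cell contract, verbatim): «discharging `BetaPertH` makes Bałaban's UV stability UNCONDITIONAL — a real constructive-QFT result; it is NOT the continuum limit and NOT the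
Clay problem.»  HONEST DEPENDENCY (verbatim): «continuum YM on T⁴ ⇐ BetaPertH ∧ nine spine estimates (0/9 proved); BetaPertH ⇐ (D1) ∧ (D4) ∧ CAP+tail; G-an2-4 gates asym, D1 and NE2/3/4.»

WHY.  The (γ) read-vector of (W-γ) is a field row-sum of `G₀ ∘ 𝒟(e)` (`𝒟(e) = dM G₀ Lc S₀ M1₀ ν y′`, a LOCALISED source) against the block pure gauge `ĝ_y`; the exit-class charge is its
`(d*d) m̃_ab`-pairing (INTENT 1).  `ward_pairing` (INTENT 2) turns that pairing into `⟨Π^ρ m̃, 𝒟(e)^F⟩ + Σ'_y Σ_κ (𝒬 m̃′) κ y·(G₀∘𝒟(e))(Lc•y, ·, inr κ, ·)`; for a PERIODIC `m` the contour sums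
are one constant per direction (INTENT 3), and THIS FILE removes `G₀` from the second term too: the coarse row sums `Σ'_y G₀ (Lc•y) z (inr κ) a` of the co-dressed resolvent are
`−Lc·colMass·𝟙^{exit}(z)` on field legs (leaf-02 g51's row source sums, every `j`) and `0` on multiplier legs (zero `mm` column mass, every `j`).  What remains for (M1) is table
algebra against three explicit forms (`Π^ρ m̃_ab`, the exit faces, `ĝ_y`) — leaf-02's `dψ`-laws — and no resolvent.
* §1 `tsum_inr_inr_coDressKBmAt_KInvStep` (every `j`, every second site: the `mm` coarse row sums vanish), `tsum_inr_row_coDressKBmAt_KInvStep` ∕ `tsum_inr_row_comp_coarse` (every `j`: `Σ'_u G_j u z (inr κ) c` over ALL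
  `u` = the coarse row sum, by `inr_row_off` + `tsum_coarse_of_off`), **`tsum_inr_row_comp_eq`** (every `j`, `W` localised: `Σ'_u (G_j∘W) u x (inr κ) b = Σ'_z Σ_l 𝟙[z_l % Lc = Lc−1]·(−Lc·colMass d Lc j l κ)·W z x (inl l) b`).
* §2 **`exitPairing_eq_source`** (`j = 0`, `m` bounded `Lc`-periodic, `W` spread and localised, in-block root):
  `Σ'_u Σ_κ (curvAdj (curv m)) κ u·(G₀∘W) u x (inl κ) b = Σ'_u Σ_κ (Π^ρ m) κ u·W u x (inl κ) b + Σ_κ (𝒬_{Lc} m κ 0)·Σ'_z Σ_l 𝟙[z_l % Lc = Lc−1]·(−Lc·colMass d Lc 0 l κ)·W z x (inl l) b`,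
  and **`exitPairing_eq_source'`** with `colMass` evaluated: `… − (Lc^{d+1})⁻¹·Σ_κ (𝒬_{Lc} m κ 0)·Σ'_z 𝟙[z_κ % Lc = Lc−1]·W z x (inl κ) b`.
* §3 **`edgePotential_pairing_eq_source`**: the instance `m = m̃_ab` (`a ≠ b`).
Asserts NO value of any read vector or table; NOTHING of (W-γ) ∕ (T-F) ∕ (INV) ∕ (S) claimed; NEVER «G-an2-4 closed» as (CONV-C); NOT D1, NOT `BetaPertH`, NOT continuum, NOT Clay.
2026-08-22; no existing file touched.
-/

noncomputable section

open Finset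
open scoped BigOperators
open Literature.Probability.LatticeModels (TorusSite Torus.proj Torus.proj_apply)
open Literature.MathematicalPhysics.QuantumFieldTheory
open Literature.MathematicalPhysics.QuantumFieldTheory.Balaban1983to89
open Literature.MathematicalPhysics.QuantumFieldTheory.Balaban1983to89.Beta
open B12Sec2to5 (l1 l1_nonneg)
open ExpKernelCalculus (MKer Decays BiLoc comp summable_exp_shift summable_exp_shift')
open AffineAveraging (Form0 Form1 Form2 box toSite unitVec unitVec_apply dz curv curvAdj contourSum)
open AveragingContours (blk off)
open RootedComb (axProjAt)
open OneStepResolventKernel (Fib)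
open OneStepKernelFamily (KInvStep colH)
open SecondOrderResponse (colM)
open Summit.QuantumFields.BalabanUV.Beta.TameKernelCalculus
open Summit.QuantumFields.BalabanUV.Beta.ChartConjugationRelative (RelInv spr_comp)
open Summit.QuantumFields.BalabanUV.Beta.AxialDressingRooted (IsCombBondAt axEc coDressKBmAt spr_coDressKBmAt decays_coDressKBmAt_KInvStep one_le_of_neZero
  axProjAt_eq_zero_of_isCombBond coDressKBmAt_KInvStep_inr_row_off coDressKBmAt_KInvStep_inr_col_off comp_inr_row_eq_zero)
open Summit.QuantumFields.BalabanUV.Beta.BorderedHessian (bhK relInv_coDressKBmAt_KInvStep_zero)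
open Summit.QuantumFields.BalabanUV.Beta.KernelWardMColumn (colM_coDressKBmAt)
open Summit.QuantumFields.BalabanUV.Beta.BorderedHessian (off_eq_zero_iff_proj)
open OneStepResolventKernel (eq_zsmul_quo_of_proj)
open LatticeForm (quo)
open Summit.QuantumFields.BalabanUV.Beta.GAN24.MultiplierZeroMass (tsum_colM_KInvStep_pos)
open Summit.QuantumFields.BalabanUV.Beta.GAN24.LinT2ZeroModeStep (colMass)
open Summit.QuantumFields.BalabanUV.Beta.GAN24.RelInvWardPairing (ward_pairing)
open Summit.QuantumFields.BalabanUV.Beta.GAN24.EdgePotentialColumnOrthogonal (abs_axProjAt_le axProjAt_eq_sub_dz contourSum_axProjAt contourSum_add_coarse)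
open Summit.QuantumFields.BalabanUV.Beta.GAN24.EdgePlaquettePotential (curvAdj_curv_sub_dz abs_edgePotential_le_one edgePotential_add_zsmul)
open Summit.QuantumFields.BalabanUV.Beta.GAN24.GaugeReadColumnSums (tsum_comp_apply_eq_rowTotals)
open Summit.QuantumFields.BalabanUV.Beta.GAN24.CoDressedColumnSourceSums (tsum_source_rowH_coDressKBm_KInvStep)
open Summit.QuantumFields.BalabanUV.Beta.GAN24.CombSlotDerivativeBorderRead (tsum_coarse_of_off)

namespace Summit.QuantumFields.BalabanUV.Beta.GAN24.ExitPairingSourceForm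

variable {d : ℕ}

/-! ## §1 The coarse multiplier-row sums of the co-dressed step resolvent (every level `j`) -/

/-- [folklore] **THE `mm` COARSE ROW SUMS VANISH, EVERY `j`, EVERY SECOND SITE**: `Σ'_y G_j (Lc•y) z (inr κ) (inr μ) = 0` (off the coarse lattice every entry is `0` —
an2's `coDressKBmAt_KInvStep_inr_col_off`; on it, an1's `colM_coDressKBmAt` + gan24-leaf-14's `tsum_colM_KInvStep_pos`). -/
theorem tsum_inr_inr_coDressKBmAt_KInvStep {Lc : ℕ} [NeZero Lc] (ρ : Fin (d + 1) → ℤ) (j : ℕ) (κ μ : Fin (d + 1)) (z : Fin (d + 1) → ℤ) :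
    ∑' y : Fin (d + 1) → ℤ, coDressKBmAt ρ Lc (KInvStep (d := d) Lc j) ((Lc : ℤ) • y) z (Sum.inr κ) (Sum.inr μ) = 0 := by
  classical
  by_cases hz : Torus.proj Lc z = 0
  · obtain ⟨y', rfl⟩ : ∃ y' : Fin (d + 1) → ℤ, z = (Lc : ℤ) • y' := ⟨quo Lc z, eq_zsmul_quo_of_proj hz⟩
    have e : ∀ y : Fin (d + 1) → ℤ, coDressKBmAt ρ Lc (KInvStep (d := d) Lc j) ((Lc : ℤ) • y) ((Lc : ℤ) • y') (Sum.inr κ) (Sum.inr μ)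
        = colM (KInvStep (d := d) Lc j) Lc μ y' κ y := fun y => by
      rw [← colM_coDressKBmAt ρ Lc (KInvStep (d := d) Lc j) μ y' κ y]; rfl
    simp only [e]
    exact tsum_colM_KInvStep_pos j μ y' κ
  · have e : ∀ y : Fin (d + 1) → ℤ, coDressKBmAt ρ Lc (KInvStep (d := d) Lc j) ((Lc : ℤ) • y) z (Sum.inr κ) (Sum.inr μ) = 0 := fun y =>
      coDressKBmAt_KInvStep_inr_col_off ρ j hz _ _ μ
    simp only [e, tsum_zero]

/-- [folklore] **THE MULTIPLIER-ROW SUM OVER ALL FINE SITES IS THE COARSE ROW SUM** (the multiplier rows of `G_j` vanish off the coarse lattice — an2's `coDressKBmAt_KInvStep_inr_row_off`). -/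
theorem tsum_inr_row_coDressKBmAt_KInvStep {Lc : ℕ} [NeZero Lc] (ρ : Fin (d + 1) → ℤ) (j : ℕ) (κ : Fin (d + 1)) (z : Fin (d + 1) → ℤ) (c : Fib d) :
    ∑' u : Fin (d + 1) → ℤ, coDressKBmAt ρ Lc (KInvStep (d := d) Lc j) u z (Sum.inr κ) c
      = ∑' y : Fin (d + 1) → ℤ, coDressKBmAt ρ Lc (KInvStep (d := d) Lc j) ((Lc : ℤ) • y) z (Sum.inr κ) c := by
  classical
  refine tsum_coarse_of_off (one_le_of_neZero Lc) (f := fun u => coDressKBmAt ρ Lc (KInvStep (d := d) Lc j) u z (Sum.inr κ) c) fun p hp => ?_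
  have hp' : Torus.proj Lc p ≠ 0 := fun h => hp ((off_eq_zero_iff_proj p).2 h)
  exact coDressKBmAt_KInvStep_inr_row_off ρ j hp' z κ c

/-- [folklore] The multiplier rows of `G_j ∘ W` vanish off the coarse lattice, so their sum over all fine sites is the coarse row sum. -/
theorem tsum_inr_row_comp_coarse {Lc : ℕ} [NeZero Lc] (ρ : Fin (d + 1) → ℤ) (j : ℕ) (W : MKer (d + 1) (Fib d)) (κ : Fin (d + 1)) (x : Fin (d + 1) → ℤ) (b : Fib d) :
    ∑' u, comp (coDressKBmAt ρ Lc (KInvStep (d := d) Lc j)) W u x (Sum.inr κ) b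
      = ∑' y : Fin (d + 1) → ℤ, comp (coDressKBmAt ρ Lc (KInvStep (d := d) Lc j)) W ((Lc : ℤ) • y) x (Sum.inr κ) b := by
  classical
  refine tsum_coarse_of_off (one_le_of_neZero Lc) (f := fun u => comp (coDressKBmAt ρ Lc (KInvStep (d := d) Lc j)) W u x (Sum.inr κ) b) fun p hp => ?_
  have hp' : Torus.proj Lc p ≠ 0 := fun h => hp ((off_eq_zero_iff_proj p).2 h)
  exact comp_inr_row_eq_zero _ _ (fun y f => coDressKBmAt_KInvStep_inr_row_off ρ j hp' y κ f) x b

/-- NOT IN PRINT; OUR BOOKKEEPING.  **THE MULTIPLIER-ROW SUM OF `G_j ∘ W` IS A SOURCE PAIRING WITH THE EXIT FACES** (every `j`, in-block root, `W` localised):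
`Σ'_u (G_j∘W) u x (inr κ) b = Σ'_z Σ_l 𝟙[z_l % Lc = Lc−1]·(−Lc·colMass d Lc j l κ)·W z x (inl l) b` — Fubini (leaf-06 g45), the multiplier-leg row sums vanish (§1), the field-leg row
sums are leaf-02 g51's ROW SOURCE SUMS. -/
theorem tsum_inr_row_comp_eq {Lc : ℕ} [NeZero Lc] {r : Fin (d + 1) → ℕ} (hr : r ∈ box (d + 1) Lc) (j : ℕ) {W : MKer (d + 1) (Fib d)} {CW δW : ℝ}
    {p₀ q₀ : Fin (d + 1) → ℤ} (hW : BiLoc W p₀ q₀ CW δW) (hδW : 0 < δW) (κ : Fin (d + 1)) (x : Fin (d + 1) → ℤ) (b : Fib d) :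
    ∑' u, comp (coDressKBmAt (toSite r) Lc (KInvStep (d := d) Lc j)) W u x (Sum.inr κ) b
      = ∑' z, ∑ l : Fin (d + 1), (if z l % (Lc : ℤ) = (Lc : ℤ) - 1 then (Lc : ℝ) * (-colMass d Lc j l κ) else 0) * W z x (Sum.inl l) b := by
  obtain ⟨δG, CG, hδG, -, hG⟩ := decays_coDressKBmAt_KInvStep (d := d) hr j
  rw [tsum_comp_apply_eq_rowTotals hG hδG hW hδW x (Sum.inr κ) b]
  refine tsum_congr fun z => ?_
  rw [Fintype.sum_sum_type]
  have hF : ∀ l : Fin (d + 1), (∑' u, coDressKBmAt (toSite r) Lc (KInvStep (d := d) Lc j) u z (Sum.inr κ) (Sum.inl l))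
      = if z l % (Lc : ℤ) = (Lc : ℤ) - 1 then (Lc : ℝ) * (-colMass d Lc j l κ) else 0 := fun l => by
    rw [tsum_inr_row_coDressKBmAt_KInvStep, tsum_source_rowH_coDressKBm_KInvStep hr j κ l z]
  have hM : ∀ μ : Fin (d + 1), (∑' u, coDressKBmAt (toSite r) Lc (KInvStep (d := d) Lc j) u z (Sum.inr κ) (Sum.inr μ)) = 0 := fun μ => by
    rw [tsum_inr_row_coDressKBmAt_KInvStep, tsum_inr_inr_coDressKBmAt_KInvStep]
  simp only [hF, hM, zero_mul, Finset.sum_const_zero, add_zero]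

/-! ## §2 The exit pairing of a dressed column is a source pairing -/

/-- NOT IN PRINT; OUR BOOKKEEPING.  **THE `(d*d)`-PAIRING OF A BOUNDED `Lc`-PERIODIC 1-FORM WITH A FIELD COLUMN OF `G₀ ∘ W` IS A SOURCE PAIRING** (`j = 0`, in-block root `ρ = toSite r`,
`W` spread and localised, `m` bounded and `Lc`-periodic):
`Σ'_u Σ_κ (curvAdj (curv m)) κ u·(G₀∘W) u x (inl κ) b = Σ'_u Σ_κ (Π^ρ m) κ u·W u x (inl κ) b + Σ_κ (𝒬_{Lc} m κ 0)·Σ'_z Σ_l 𝟙[z_l % Lc = Lc−1]·(−Lc·colMass d Lc 0 l κ)·W z x (inl l) b` —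
`ward_pairing` for the hard-axial representative, the contour sums of a periodic form are one constant per direction (`contourSum_axProjAt`, `contourSum_add_coarse`), and §1. -/
theorem exitPairing_eq_source {Lc : ℕ} [NeZero Lc] {r : Fin (d + 1) → ℕ} (hr : r ∈ box (d + 1) Lc) {W : MKer (d + 1) (Fib d)} (hWs : Spr W) {CW δW : ℝ}
    {p₀ q₀ : Fin (d + 1) → ℤ} (hW : BiLoc W p₀ q₀ CW δW) (hδW : 0 < δW) {m : Form1 (d + 1) ℝ} {B : ℝ} (hmB : ∀ κ u, |m κ u| ≤ B)
    (hper : ∀ κ x v, m κ (x + (Lc : ℤ) • v) = m κ x) (x : Fin (d + 1) → ℤ) (b : Fib d) :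
    ∑' u, ∑ κ, curvAdj (curv m) κ u * comp (coDressKBmAt (toSite r) Lc (KInvStep (d := d) Lc 0)) W u x (Sum.inl κ) b
      = (∑' u, ∑ κ, axProjAt (toSite r) Lc m κ u * W u x (Sum.inl κ) b)
        + ∑ κ, contourSum Lc m κ 0 *
            ∑' z, ∑ l : Fin (d + 1), (if z l % (Lc : ℤ) = (Lc : ℤ) - 1 then (Lc : ℝ) * (-colMass d Lc 0 l κ) else 0) * W z x (Sum.inl l) b := by
  classical
  have hLc : 1 ≤ Lc := one_le_of_neZero Lc
  set m' : Form1 (d + 1) ℝ := axProjAt (toSite r) Lc m with hm'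
  have hm'B : ∀ κ u, |m' κ u| ≤ B + 2 * ((((d + 1 : ℕ) : ℝ)) * Lc * B) := fun κ u => abs_axProjAt_le hLc hr hmB κ u
  have hm'0 : ∀ κ u, IsCombBondAt (toSite r) Lc κ u → m' κ u = 0 := fun κ u h => axProjAt_eq_zero_of_isCombBond h m
  have hdd : curvAdj (curv m) = curvAdj (curv m') := by rw [hm', axProjAt_eq_sub_dz, curvAdj_curv_sub_dz]
  have hGs : Spr (coDressKBmAt (toSite r) Lc (KInvStep (d := d) Lc 0)) :=
    spr_coDressKBmAt hLc hr (by obtain ⟨δ, C, hδ, -, h⟩ := OneStepKernelFamily.decays_KInvStep (d := d) (Lc := Lc) 0; exact ⟨C, δ, hδ, h⟩)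
  rw [hdd, ward_pairing (relInv_coDressKBmAt_KInvStep_zero hr) hGs hWs hm'B hm'0 x b]
  congr 1
  -- the multiplier term: constant contour sums × the coarse row sums of `G₀ ∘ W`
  have h2 : ∀ y κ, contourSum Lc m' κ y = contourSum Lc m κ 0 := fun y κ => by
    rw [hm', contourSum_axProjAt hLc (toSite r) hper]
    have := contourSum_add_coarse hper κ 0 y
    rwa [zero_add] at this
  simp only [h2]
  obtain ⟨C, δ, hδ, hVd⟩ := spr_comp hGs hWs
  have hsum : ∀ κ, Summable fun y : Fin (d + 1) → ℤ => comp (coDressKBmAt (toSite r) Lc (KInvStep (d := d) Lc 0)) W ((Lc : ℤ) • y) x (Sum.inr κ) b := by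
    intro κ
    have hinj : Function.Injective (fun y : Fin (d + 1) → ℤ => (Lc : ℤ) • y) :=
      smul_right_injective (Fin (d + 1) → ℤ) (show (Lc : ℤ) ≠ 0 by exact_mod_cast NeZero.ne Lc)
    have hmaj : Summable fun y : Fin (d + 1) → ℤ => C * Real.exp (-δ * l1 ((Lc : ℤ) • y - x)) :=
      ((summable_exp_shift' hδ x).mul_left C).comp_injective hinj
    refine Summable.of_norm_bounded hmaj (fun y => ?_)
    rw [Real.norm_eq_abs]
    exact hVd _ _ _ _
  rw [Summable.tsum_finsetSum (fun κ _ => (hsum κ).mul_left _)]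
  refine Finset.sum_congr rfl fun κ _ => ?_
  rw [tsum_mul_left, ← tsum_inr_row_comp_coarse (toSite r) 0 W κ x b, tsum_inr_row_comp_eq hr 0 hW hδW κ x b]

/-- [folklore] `colMass` at level `0`, summed against the exit indicators: `Σ_l 𝟙^{exit}_l(z)·(−Lc·colMass d Lc 0 l κ)·W_l = −(Lc^{d+1})⁻¹·𝟙^{exit}_κ(z)·W_κ`. -/
theorem sum_exit_colMass_zero_mul {Lc : ℕ} [NeZero Lc] (κ : Fin (d + 1)) (z : Fin (d + 1) → ℤ) (w : Fin (d + 1) → ℝ) :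
    ∑ l : Fin (d + 1), (if z l % (Lc : ℤ) = (Lc : ℤ) - 1 then (Lc : ℝ) * (-colMass d Lc 0 l κ) else 0) * w l
      = -(((Lc : ℝ) ^ (d + 1))⁻¹) * ((if z κ % (Lc : ℤ) = (Lc : ℤ) - 1 then (1 : ℝ) else 0) * w κ) := by
  have hL : (Lc : ℝ) ≠ 0 := by exact_mod_cast NeZero.ne Lc
  have hc : ∀ l : Fin (d + 1), colMass d Lc 0 l κ = if l = κ then (((Lc : ℝ)) ^ (d + 1 + 1))⁻¹ else 0 := fun l => by
    simp only [colMass, zero_add, pow_one]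
  simp only [hc]
  rw [Finset.sum_eq_single κ (fun l _ hl => by rw [if_neg hl]; simp) (fun h => (h (Finset.mem_univ κ)).elim)]
  rw [if_pos rfl]
  split_ifs
  · field_simp
    ring
  · simp

/-- NOT IN PRINT; OUR BOOKKEEPING.  **THE SOURCE FORM WITH `colMass` EVALUATED**: under the hypotheses of `exitPairing_eq_source`,
`Σ'_u Σ_κ (d*d m) κ u·(G₀∘W) u x (inl κ) b = Σ'_u Σ_κ (Π^ρ m) κ u·W u x (inl κ) b − (Lc^{d+1})⁻¹·Σ_κ (𝒬_{Lc} m κ 0)·Σ'_z 𝟙[z_κ % Lc = Lc−1]·W z x (inl κ) b`. -/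
theorem exitPairing_eq_source' {Lc : ℕ} [NeZero Lc] {r : Fin (d + 1) → ℕ} (hr : r ∈ box (d + 1) Lc) {W : MKer (d + 1) (Fib d)} (hWs : Spr W) {CW δW : ℝ}
    {p₀ q₀ : Fin (d + 1) → ℤ} (hW : BiLoc W p₀ q₀ CW δW) (hδW : 0 < δW) {m : Form1 (d + 1) ℝ} {B : ℝ} (hmB : ∀ κ u, |m κ u| ≤ B)
    (hper : ∀ κ x v, m κ (x + (Lc : ℤ) • v) = m κ x) (x : Fin (d + 1) → ℤ) (b : Fib d) :
    ∑' u, ∑ κ, curvAdj (curv m) κ u * comp (coDressKBmAt (toSite r) Lc (KInvStep (d := d) Lc 0)) W u x (Sum.inl κ) b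
      = (∑' u, ∑ κ, axProjAt (toSite r) Lc m κ u * W u x (Sum.inl κ) b)
        - (((Lc : ℝ) ^ (d + 1))⁻¹) * ∑ κ, contourSum Lc m κ 0 *
            ∑' z, (if z κ % (Lc : ℤ) = (Lc : ℤ) - 1 then (1 : ℝ) else 0) * W z x (Sum.inl κ) b := by
  rw [exitPairing_eq_source hr hWs hW hδW hmB hper x b]
  have e : ∀ κ : Fin (d + 1), (∑' z : Fin (d + 1) → ℤ, ∑ l : Fin (d + 1), (if z l % (Lc : ℤ) = (Lc : ℤ) - 1 then (Lc : ℝ) * (-colMass d Lc 0 l κ) else 0) * W z x (Sum.inl l) b)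
      = -(((Lc : ℝ) ^ (d + 1))⁻¹) * ∑' z : Fin (d + 1) → ℤ, (if z κ % (Lc : ℤ) = (Lc : ℤ) - 1 then (1 : ℝ) else 0) * W z x (Sum.inl κ) b := fun κ => by
    rw [← tsum_mul_left]
    exact tsum_congr fun z => sum_exit_colMass_zero_mul κ z (fun l => W z x (Sum.inl l) b)
  simp only [e]
  have h : ∑ κ : Fin (d + 1), contourSum Lc m κ 0 * (-(((Lc : ℝ) ^ (d + 1))⁻¹) * ∑' z : Fin (d + 1) → ℤ, (if z κ % (Lc : ℤ) = (Lc : ℤ) - 1 then (1 : ℝ) else 0) * W z x (Sum.inl κ) b)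
      = -((((Lc : ℝ) ^ (d + 1))⁻¹) * ∑ κ : Fin (d + 1), contourSum Lc m κ 0 * ∑' z : Fin (d + 1) → ℤ, (if z κ % (Lc : ℤ) = (Lc : ℤ) - 1 then (1 : ℝ) else 0) * W z x (Sum.inl κ) b) := by
    rw [Finset.mul_sum, ← Finset.sum_neg_distrib]
    exact Finset.sum_congr rfl fun κ _ => by ring
  rw [h]
  ring

/-! ## §3 The edge potential -/

/-- NOT IN PRINT; OUR BOOKKEEPING.  **THE EXIT PAIRING OF A DRESSED COLUMN, EDGE POTENTIAL** (`a ≠ b′`, `1 ≤ Lc`, in-block root, `W` spread and localised): the `(d*d) m̃_{ab′}`-pairing of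
the `(x, b)`-field-column of `G₀ ∘ W` is `⟨Π^ρ m̃_{ab′}, W^F_{·xb}⟩ − (Lc^{d+1})⁻¹·Σ_κ (𝒬_{Lc} m̃_{ab′} κ 0)·⟨𝟙^{exit}_κ, W^F_{·xb,κ}⟩` — no resolvent on the right. -/
theorem edgePotential_pairing_eq_source {Lc : ℕ} [NeZero Lc] (hLc : 1 ≤ Lc) {r : Fin (d + 1) → ℕ} (hr : r ∈ box (d + 1) Lc) {a b' : Fin (d + 1)} (hab : a ≠ b')
    {W : MKer (d + 1) (Fib d)} (hWs : Spr W) {CW δW : ℝ} {p₀ q₀ : Fin (d + 1) → ℤ} (hW : BiLoc W p₀ q₀ CW δW) (hδW : 0 < δW) (x : Fin (d + 1) → ℤ) (b : Fib d) :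
    ∑' u, ∑ κ, curvAdj (curv (fun β z =>
          ((Lc : ℝ) ^ 2)⁻¹ * ((((z + unitVec β) b' % (Lc : ℤ) : ℤ)) : ℝ) * dz (fun w : Fin (d + 1) → ℤ => ((w a : ℤ) : ℝ)) β z
          - (Lc : ℝ)⁻¹ * (((z a % (Lc : ℤ) : ℤ)) : ℝ) * dz (fun w : Fin (d + 1) → ℤ => (((w b' / (Lc : ℤ) : ℤ)) : ℝ)) β z)) κ u
        * comp (coDressKBmAt (toSite r) Lc (KInvStep (d := d) Lc 0)) W u x (Sum.inl κ) b
      = (∑' u, ∑ κ, axProjAt (toSite r) Lc (fun β z =>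
          ((Lc : ℝ) ^ 2)⁻¹ * ((((z + unitVec β) b' % (Lc : ℤ) : ℤ)) : ℝ) * dz (fun w : Fin (d + 1) → ℤ => ((w a : ℤ) : ℝ)) β z
          - (Lc : ℝ)⁻¹ * (((z a % (Lc : ℤ) : ℤ)) : ℝ) * dz (fun w : Fin (d + 1) → ℤ => (((w b' / (Lc : ℤ) : ℤ)) : ℝ)) β z) κ u * W u x (Sum.inl κ) b)
        - (((Lc : ℝ) ^ (d + 1))⁻¹) * ∑ κ, contourSum Lc (fun β z =>
          ((Lc : ℝ) ^ 2)⁻¹ * ((((z + unitVec β) b' % (Lc : ℤ) : ℤ)) : ℝ) * dz (fun w : Fin (d + 1) → ℤ => ((w a : ℤ) : ℝ)) β z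
          - (Lc : ℝ)⁻¹ * (((z a % (Lc : ℤ) : ℤ)) : ℝ) * dz (fun w : Fin (d + 1) → ℤ => (((w b' / (Lc : ℤ) : ℤ)) : ℝ)) β z) κ 0 *
            ∑' z, (if z κ % (Lc : ℤ) = (Lc : ℤ) - 1 then (1 : ℝ) else 0) * W z x (Sum.inl κ) b :=
  exitPairing_eq_source' hr hWs hW hδW (B := 1) (fun κ u => abs_edgePotential_le_one hLc hab κ u)
    (fun κ z v => edgePotential_add_zsmul hLc hab κ z v) x b

end Summit.QuantumFields.BalabanUV.Beta.GAN24.ExitPairingSourceForm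

end
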